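/-
Copyright (c) 2026. All rights reserved.
Released under Apache 2.0 license as described in the file LICENSE.
-/
import Mathlib
import HarnessLib
import Summits.RiemannHypothesis.RiemannHypothesis.Theorems.EarlyAppointmentsExactComb
import Summits.RiemannHypothesis.RiemannHypothesis.Theorems.EarlyAppointmentsCothBound

/-!
# Exact comb sum bound

This file proves bounds on the exact comb sum at a pure imaginary argument, using the cotangent
series representation. The key result: for h ≥ 2s, the exact comb sum plus iπ/s has norm ≤ 2/h.

## Main results

* `exactCombSum_formula`: For z = (h/s)I, the scaled cotangent series plus iπ/s equals
  I * (π/s * (1 - cosh(πh/s)/sinh(πh/s)) + 1/h).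
* `norm_exactCombSum_le`: For h ≥ 2s, this has norm ≤ 2/h.

## Mathematical background

For z = (h/s)I with h, s > 0, the Mathlib cotangent series `cot_series_rep'` gives:
  ∑_{n ∈ ℕ} (1/(z-(n+1)) + 1/(z+(n+1))) = π cot(πz) - 1/z

At pure imaginary argument: cot(πz) = cot(π(h/s)I) = -I cosh(πh/s)/sinh(πh/s)
(via `EarlyAppointmentsExactComb.cot_mul_I_eq`).

This gives the exact comb sum formula. For h ≥ 2s, the coth-like term is close to 1,
making the expression approximately I/h, hence norm ≤ 2/h.
-/

open Complex Real Set Filter Topology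
open scoped BigOperators Topology

noncomputable section

namespace EarlyAppointmentsExactCombBound

/-- Norm of I * r for real r. -/
theorem norm_I_mul_real (r : ℝ) : ‖Complex.I * (r : ℂ)‖ = |r| := by
  rw [Complex.norm_mul, Complex.norm_I, one_mul, Complex.norm_real, Real.norm_eq_abs]

/-- The cotangent at pure imaginary argument: cot(π(h/s)I) = -I·cosh(πh/s)/sinh(πh/s). -/
theorem cot_at_pure_imag {h s : ℝ} (hh : 0 < h) (hs : 0 < s) :
    Complex.cot (π * (((h / s : ℝ) : ℂ) * Complex.I)) =
      -Complex.I * (Real.cosh (π * h / s) / Real.sinh (π * h / s)) := by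
  have hne : π * h / s ≠ 0 := by positivity
  have heq : (π : ℂ) * (((h / s : ℝ) : ℂ) * Complex.I) = ((π * h / s : ℝ) : ℂ) * Complex.I := by
    push_cast; ring
  rw [heq]
  exact EarlyAppointmentsExactComb.cot_mul_I_eq hne

/-- 1/((h/s)I) = -I(s/h). -/
theorem inv_pure_imag {h s : ℝ} (hh : 0 < h) (hs : 0 < s) :
    (1 : ℂ) / (((h / s : ℝ) : ℂ) * Complex.I) = -Complex.I * (s / h) := by
  have _hne : (h / s : ℝ) ≠ 0 := by positivity
  rw [one_div, mul_inv, Complex.inv_I]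
  simp only [Complex.ofReal_div]
  have hs' : (s : ℂ) ≠ 0 := Complex.ofReal_ne_zero.mpr (ne_of_gt hs)
  have _hh' : (h : ℂ) ≠ 0 := Complex.ofReal_ne_zero.mpr (ne_of_gt hh)
  rw [inv_div]
  ring

/-- For h ≥ 2s, πh/s ≥ 1. -/
theorem pi_h_div_s_ge_one {h s : ℝ} (_hh : 0 < h) (hs : 0 < s) (hhs : 2 * s ≤ h) :
    1 ≤ π * h / s := by
  have hπ : 3 < π := Real.pi_gt_three
  have key : 2 ≤ h / s := by rw [le_div_iff₀ hs]; linarith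
  have h1 : 1 < π := by linarith
  have h2 : π ≤ π * (h / s) := by nlinarith [Real.pi_pos]
  have h3 : π * (h / s) = π * h / s := by ring
  linarith

/-- The exact comb sum formula: (1/s) * series + iπ/s = I * (real expression).

For z = (h/s)I, the Mathlib cotangent series gives:
  ∑_{n≥0} (1/(z-(n+1)) + 1/(z+(n+1))) = π cot(πz) - 1/z

Multiplying by 1/s and adding iπ/s yields I * (π/s * (1 - cosh/sinh) + 1/h). -/
theorem exactCombSum_formula {h s : ℝ} (hh : 0 < h) (hs : 0 < s) :
    (1 / s : ℂ) * ∑' n : ℕ, (1 / (((h / s : ℝ) : ℂ) * Complex.I - (n + 1)) +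
                             1 / (((h / s : ℝ) : ℂ) * Complex.I + (n + 1)))
      + Complex.I * π / s
      = Complex.I * ((π / s * (1 - Real.cosh (π * h / s) / Real.sinh (π * h / s)) + 1 / h : ℝ) : ℂ) := by
  have hz : (h / s : ℝ) * Complex.I ∈ Complex.integerComplement :=
    EarlyAppointmentsExactComb.pure_imag_mem_integerComplement hh hs
  have hcot := cot_series_rep' hz
  have step1 : (1 / s : ℂ) * ∑' n : ℕ, (1 / (((h / s : ℝ) : ℂ) * Complex.I - (n + 1)) +
                                         1 / (((h / s : ℝ) : ℂ) * Complex.I + (n + 1)))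
      = (1 / s : ℂ) * (π * Complex.cot (π * (((h / s : ℝ) : ℂ) * Complex.I))
                       - 1 / (((h / s : ℝ) : ℂ) * Complex.I)) := by
    rw [← hcot]
  rw [step1, cot_at_pure_imag hh hs, inv_pure_imag hh hs]
  push_cast
  have hs' : (s : ℂ) ≠ 0 := Complex.ofReal_ne_zero.mpr (ne_of_gt hs)
  have hh' : (h : ℂ) ≠ 0 := Complex.ofReal_ne_zero.mpr (ne_of_gt hh)
  have hsinh : (Real.sinh (π * h / s) : ℂ) ≠ 0 := by
    rw [Complex.ofReal_ne_zero]
    exact Real.sinh_ne_zero.mpr (by positivity)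
  field_simp
  ring

/-- The norm bound for the exact comb sum + iπ/s: for h ≥ 2s, this is ≤ 2/h.

The proof uses the cosh/sinh decay bound from `EarlyAppointmentsCothBound.abs_coth_sub_one_le`:
for x ≥ 1, |cosh(x)/sinh(x) - 1| ≤ 3·exp(-2x). Since πh/s ≥ 2π when h ≥ 2s, the exponential
decay ensures the bound. -/
theorem norm_exactCombSum_le {h s : ℝ} (hh : 0 < h) (hs : 0 < s) (hhs : 2 * s ≤ h) :
    ‖(1 / s : ℂ) * ∑' n : ℕ, (1 / (((h / s : ℝ) : ℂ) * Complex.I - (n + 1)) +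
                               1 / (((h / s : ℝ) : ℂ) * Complex.I + (n + 1)))
      + Complex.I * π / s‖ ≤ 2 / h := by
  rw [exactCombSum_formula hh hs, norm_I_mul_real]
  have harg := pi_h_div_s_ge_one hh hs hhs
  have hcoth := EarlyAppointmentsCothBound.abs_coth_sub_one_le harg
  have h1 : |1 - Real.cosh (π * h / s) / Real.sinh (π * h / s)| =
      |Real.cosh (π * h / s) / Real.sinh (π * h / s) - 1| := abs_sub_comm _ _
  calc |π / s * (1 - Real.cosh (π * h / s) / Real.sinh (π * h / s)) + 1 / h|
      ≤ |π / s * (1 - Real.cosh (π * h / s) / Real.sinh (π * h / s))| + |1 / h| := abs_add_le _ _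
    _ = π / s * |1 - Real.cosh (π * h / s) / Real.sinh (π * h / s)| + 1 / h := by
        rw [abs_mul, abs_of_pos (by positivity : 0 < π / s), abs_of_pos (by positivity : 0 < 1 / h)]
    _ = π / s * |Real.cosh (π * h / s) / Real.sinh (π * h / s) - 1| + 1 / h := by rw [h1]
    _ ≤ π / s * (3 * Real.exp (-2 * (π * h / s))) + 1 / h := by gcongr
    _ ≤ 2 / h := by
        have hhs' : h / s ≥ 2 := by rw [ge_iff_le, le_div_iff₀ hs]; linarith
        -- π/s * 3 * exp(-2πh/s) ≤ 1/h: exponential decay dominates for h/s ≥ 2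
        -- Proof: π/s * exp(-2πh/s) = (π/h) * (h/s) * exp(-2π(h/s))
        -- For t = h/s ≥ 2: t * exp(-2πt) ≤ 2 * exp(-4π) ≈ 7e-6
        -- So 3π * 2 * exp(-4π) / h ≈ 6.6e-5 / h < 1/h
        -- Key bound: 6π·exp(-4π) < 1
        have h_6π_exp_lt_1 : 6 * π * Real.exp (-4 * π) < 1 := by
          -- exp(12) ≥ 100000
          have h_exp12 : (100000 : ℝ) ≤ Real.exp 12 := by
            have he := Real.exp_one_gt_d9
            have heq : Real.exp 12 = Real.exp 1 ^ 12 := by rw [← Real.exp_nat_mul]; norm_num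
            rw [heq]
            have h2 : (2.7182818283 : ℝ) ^ 12 ≤ Real.exp 1 ^ 12 :=
              pow_le_pow_left₀ (by norm_num) he.le 12
            have h3 : (100000 : ℝ) ≤ (2.7182818283 : ℝ) ^ 12 := by norm_num
            linarith
          -- 4π > 12
          have h_4π : 4 * π > 12 := by nlinarith [Real.pi_gt_three]
          -- exp(4π) > 100000 > 6π
          have h_exp4π : Real.exp (4 * π) > 6 * π := by
            have h6π : 6 * π < 24 := by nlinarith [Real.pi_lt_four]
            calc Real.exp (4 * π) > Real.exp 12 := Real.exp_lt_exp.mpr h_4π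
              _ ≥ 100000 := h_exp12
              _ > 6 * π := by linarith
          have h6π_pos : 0 < 6 * π := by positivity
          calc 6 * π * Real.exp (-4 * π)
              = 6 * π / Real.exp (4 * π) := by
                  rw [show (-4 : ℝ) * π = -(4 * π) by ring, Real.exp_neg]; ring
            _ < 6 * π / (6 * π) := by
                apply div_lt_div_of_pos_left h6π_pos (by linarith) h_exp4π
            _ = 1 := div_self (ne_of_gt h6π_pos)
        -- Monotonicity: for t ≥ 2, t·exp(-2πt) ≤ 2·exp(-4π)
        have h_mono : (h / s) * Real.exp (-2 * π * (h / s)) ≤ 2 * Real.exp (-4 * π) := by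
          have ht : h / s ≥ 2 := hhs'
          have haux : (h / s) / 2 ≤ Real.exp (2 * π * ((h / s) - 2)) := by
            have hu : h / s - 2 ≥ 0 := by linarith
            have h_exp_ge : 1 + (h / s - 2) ≤ Real.exp (2 * π * (h / s - 2)) := by
              have he := Real.add_one_le_exp (2 * π * (h / s - 2))
              have hπ1 : 2 * π > 1 := by nlinarith [Real.pi_gt_three]
              have hπ : 2 * π * (h / s - 2) ≥ h / s - 2 := by nlinarith [hu, hπ1]
              calc 1 + (h / s - 2) ≤ 1 + 2 * π * (h / s - 2) := by linarith
                _ = 2 * π * (h / s - 2) + 1 := by ring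
                _ ≤ Real.exp (2 * π * (h / s - 2)) := he
            calc (h / s) / 2 = 1 + (h / s - 2) / 2 := by ring
              _ ≤ 1 + (h / s - 2) := by nlinarith
              _ ≤ Real.exp (2 * π * ((h / s) - 2)) := h_exp_ge
          have hrw : -2 * π * (h / s) = -4 * π + 2 * π * (2 - h / s) := by ring
          calc (h / s) * Real.exp (-2 * π * (h / s))
              = (h / s) * Real.exp (-4 * π + 2 * π * (2 - h / s)) := by rw [hrw]
            _ = (h / s) * (Real.exp (-4 * π) * Real.exp (2 * π * (2 - h / s))) := by
                rw [Real.exp_add]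
            _ = (h / s) * Real.exp (2 * π * (2 - h / s)) * Real.exp (-4 * π) := by ring
            _ ≤ 2 * Real.exp (-4 * π) := by
                have hrw2 : 2 * π * (2 - h / s) = -(2 * π * ((h / s) - 2)) := by ring
                have hexp_pos : 0 < Real.exp (2 * π * ((h / s) - 2)) := Real.exp_pos _
                have h_factor : (h / s) * Real.exp (2 * π * (2 - h / s)) ≤ 2 := by
                  rw [hrw2, Real.exp_neg]
                  have h_t_bound : (h / s) ≤ 2 * Real.exp (2 * π * ((h / s) - 2)) := by
                    nlinarith [haux]
                  calc (h / s) * (Real.exp (2 * π * ((h / s) - 2)))⁻¹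
                      = (h / s) / Real.exp (2 * π * ((h / s) - 2)) := by
                        field_simp
                    _ ≤ (2 * Real.exp (2 * π * ((h / s) - 2))) /
                          Real.exp (2 * π * ((h / s) - 2)) := by
                        apply div_le_div_of_nonneg_right h_t_bound hexp_pos.le
                    _ = 2 := by field_simp
                nlinarith [Real.exp_pos (-4 * π), h_factor]
        have hnum : π / s * (3 * Real.exp (-2 * (π * h / s))) ≤ 1 / h := by
          have heq : π / s * (3 * Real.exp (-2 * (π * h / s))) =
              (3 * π / h) * ((h / s) * Real.exp (-2 * π * (h / s))) := by
            field_simp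
          calc π / s * (3 * Real.exp (-2 * (π * h / s)))
              = (3 * π / h) * ((h / s) * Real.exp (-2 * π * (h / s))) := heq
            _ ≤ (3 * π / h) * (2 * Real.exp (-4 * π)) := by
                apply mul_le_mul_of_nonneg_left h_mono; positivity
            _ = 6 * π * Real.exp (-4 * π) / h := by ring
            _ ≤ 1 / h := by
                apply div_le_div_of_nonneg_right _ hh.le
                linarith
        calc π / s * (3 * Real.exp (-2 * (π * h / s))) + 1 / h
            ≤ 1 / h + 1 / h := by linarith
          _ = 2 / h := by ring

end EarlyAppointmentsExactCombBound

end
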